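import Mathlib
import HarnessLib
import HarnessLib.Audit
import Summits.AtomisticToContinuum.Statement
import Literature.MathematicalPhysics.KineticTheory.LangevinChainKernel
import Literature.MathematicalPhysics.KineticTheory.LangevinChainGibbs
import Literature.MathematicalPhysics.KineticTheory.LangevinChainNESS
import Summits.AtomisticToContinuum.FouriersLaw.Theorems.EmbeddedDrudeMourreNessUnique

/-!
Route: ContactEchoWindows

CLOSED (retired) 2026-08-15T13:41:25Z by operator:999:1257524 — reason: not-a-thesis: assembly does not conclude the sub-problem Statement — note: D-0027 §2.1 audit (human 2026-08-15: routes that do not decide the summit are removed): the assembly concludes `Literature.MathematicalPhysics.KineticTheory.HeatConduction.FouriersLaw`, not the sub-problem statement; a NEW conforming route may be opened from the same idea (generated `closes : … → _r. The file is kept as the record of this route; refuted decls are indexed as negative knowledge (`ledger negatives`).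

# Route ContactEchoWindows — conductance is the time-integrated contact-to-contact power echo;
Fourier's law from dark time + equilibrium fluctuation window + polynomial gap tail

X_E (CONTACT-ECHO LINE; realises card contact-cross-correlation-three-windows). Notation, all in the
tree: P = pinnedChain ω₂ lam β γ
(ω₂, lam, β, γ > 0), N = n + 2 ≥ 2 sites, μ_T = P.gibbsMeasure N T (equilibrium, both baths at T >
0), P_t = P.transitionKernel N T T t
(the CONSTRUCTED transition kernels of the Langevin SDE), contact powers w_L(z) = γ(T − p_0²),
w_R(z) = γ(T − p_(N−1)²), and the
contact echo c_N(t) := ∫ w_L · (P_t w_R) dμ_T. It suffices to show, for all parameters and every T >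
0:
(K) ContactKubo [support, fixed N]: under weak-NESS uniqueness the finite-N response exists and D_N
= lim_δ totalCurrent/δ = (N−1) T⁻² ∫₀^∞ c_N(t) dt
    (conductance = time-integrated contact-to-contact power echo; no O(1) subtraction);
(W1) DarkTime: ∃ v > 0, (N−1) T⁻² ∫₀^(N/v) |c_N| → 0 (finite speed: the right contact has not yet
heard the left one);
(W2) EquilibriumFluctuationWindow: ∃ κ > 0, ∀ v > 0, ∀ a > 2, (N−1) T⁻² ∫_(N/v)^(N^a) c_N → κ
(diffusive epoch; κ(T) is DEFINED here);
(W3) PolynomialGapTail: ∃ a > 2, (N−1) T⁻² ∫_(N^a)^∞ |c_N| → 0 (exponential forgetting with a merely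
POLYNOMIAL-in-N rate).
Then D_N → κ(T) ∈ (0, ∞) (split one time integral in three), i.e. clause (ii) of FouriersLawFor;
clause (i) = landed existence fact
CuneoEckmannHairerReyBellet2018_pinnedChain + NessUnique (item shared with route FourierGreenKubo).
X_E = K ∧ W1 ∧ W2 ∧ W3.
Lean: `ContactKubo ∧ DarkTime ∧ EquilibriumFluctuationWindow ∧ PolynomialGapTail` (each conjunct =
the one-line Prop of the item below; the target EchoLimit `∃ κ > 0, Tendsto (n ↦ ((n:ℝ)+1)/T^2 * ∫ t
in Set.Ioi 0, c_(n+2) t) atTop (nhds κ)` is their common consequence)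

## Assembly
Fix parameters. Clause (i): existence from the fact CuneoEckmannHairerReyBellet2018_pinnedChain (N ≥
1) and OscillatorChain.isSteadyState_zero
(N = 0), uniqueness from NessUnique. Clause (ii): κ(T) := the κ of EquilibriumFluctuationWindow at T
for T > 0 (Classical.choose; 1 otherwise),
positive by W2. Given a steady-state family μ and T > 0 put D N := (N−1) T⁻² ∫₀^∞ c_N for N ≥ 2 and
D 0 = D 1 := 0 (totalCurrent vanishes
identically for N ≤ 1: no bonds); the per-N response limits are ContactKubo (N ≥ 2) and
`tendsto_const_nhds` after `zero_div` (N ≤ 1);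
D (n+2) → κ by the window split of EchoLimitOfWindows, then `Filter.tendsto_add_atTop_iff_nat`.
Verified shape: the term below elaborates
(planner Sketch.lean, rc 0); the glue is dominated splitting of one time integral plus bookkeeping
(~150 lines).

Rationale: WHY THIS LINE. BLR's limit takes δT → 0 first, so everything after the (fixed-N, hypoelliptic)
linear response is EQUILIBRIUM dynamics of the OPEN chain;
writing the response in the contact-to-contact form G_N T² = ∫₀^∞ ⟨w_L, P_t w_R⟩_(μ_T) dt (cross
form of the open-system Green–Kubo formula:
JaksicOgataPillet2006 eq. (1.1)/§2.4 quantum, MaesNetocnyVerschuere2003 / KunduDharNarayan2009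
classical mixed forms; the white-noise sum rule
⟨w_L, (−L)⁻¹(w_L + w_R)⟩ = γT² from L H = w_L + w_R,
`Literature.Barriers.AtomisticToContinuum.generator_hamiltonian_two_baths`, removes the O(1)
auto term) makes the integrand itself O(1/N) and splits the proof of D_N → κ along the three
physical epochs of the echo, each owned by a
different existing technology: classical Lieb–Robinson / finite-speed bounds at positive temperature
(NachtergaeleEtAl2008, RazSims2009,
ButtaEtAl2007, MarchioroPellegrinottiPulvirenti1978) for W1; equilibrium energy-fluctuation limits
with thermal boundaries (Bernardin2014 §3,
KomorowskiOlla2020, KomorowskiOlla2021, KomorowskiOllaSimon2021 — noisy/harmonic so far) for W2; the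
quantitative N-dependent ergodicity
programme (Menegaki2020, BeckerMenegaki2022, CuneoEckmannHairerReyBellet2018) for W3, of which only
a POLYNOMIAL rate is asked — the catalogued
gap-closing barrier is embraced, not fought. Imported areas: quasi-locality estimates
(quantum-lattice style LR bounds, classical version),
hydrodynamic fluctuation theory, hypocoercive/Harris quantitative ergodicity. What it does that
route FourierGreenKubo does not: no
infinite-volume dynamics, no L¹(0,∞) Green–Kubo integrability of the bulk current autocorrelation,
no κ = κ_GK identification (BLR §7) — the
conductivity is defined on the open chain in the diffusive window, and finiteness comes from the
W1/W3 cut-offs. Negatives index: empty.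

RANKED CRUXES. #0 EchoLimit (target) — CONTACT-ECHO FORM OF FOURIER'S LAW: for all ω₂, lam, β, γ > 0
and T > 0 there is κ > 0 with (N−1) T⁻² ∫₀^∞ c_N(t) dt → κ as N → ∞ (N = n+2; c_N as in the Thesis;
the set integral is Lean-junk 0 unless c_N ∈ L¹(0,∞), which ContactKubo supplies). With ContactKubo
this is exactly "D_N → κ(T) ∈ (0,∞)". (why it might fail: inherits W2 (a deterministic-chain
equilibrium fluctuation limit, MacroErgodicity class) and W3 (no N-polynomial relaxation bound
exists beyond near-harmonic chains); κ might exist only along subsequences if hyperbolic/polynomial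
windows carry mass.) [BonettoLebowitzReyBellet2000, KunduDharNarayan2009, JaksicOgataPillet2006,
Bernardin2014, BeckerMenegaki2022]
#2 EquilibriumFluctuationWindow (crux) — (W2, card crux 1) for all parameters > 0 and T > 0 there is
κ > 0 such that for EVERY v > 0 and EVERY a > 2: (N−1) T⁻² ∫_(N/v)^(N^a) c_N(t) dt → κ. Informally:
on diffusive scales N³ c_N(N² s) → T² K(s), K = contact-to-contact flux kernel of ∂_s e = κ ∂_x² e
on [0,1] with thermalising (Robin/Kapitza) boundary conditions, ∫₀^∞ K = κ, with enough uniform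
integrability that hyperbolic times t ∈ [N/v, εN²] and polynomial times t ∈ [AN², N^a] carry o(1/N);
an EQUILIBRIUM energy-fluctuation limit for two boundary observables of the OPEN chain
(Ornstein–Uhlenbeck fluctuation field + Boltzmann–Gibbs principle for w_L, w_R), the corner where
κ(T) is defined. [difficulty: open-problem] (why it might fail: Boltzmann–Gibbs /
fluctuation–dissipation for a DETERMINISTIC anharmonic chain is open even at equilibrium
(MacroErgodicity class); the contact boundary condition (Kapitza length) is identified only for
harmonic/noisy chains; '∀ a' also asserts no mass at polynomial times ≫ N².) [Bernardin2014,
KomorowskiOlla2021, KomorowskiOllaSimon2021, KomorowskiOlla2020, BonettoLebowitzReyBellet2000,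
arXiv:2310.13338]
#3 PolynomialGapTail (crux) — (W3, card crux 2, integrated form) for all parameters > 0 and T > 0
there is a > 2 such that t ↦ c_N(t) is integrable on (N^a, ∞) for every N and (N−1) T⁻² ∫_(N^a)^∞
|c_N(t)| dt → 0. Sufficient: an L²(μ_T) relaxation bound for the contact observable with POLYNOMIAL
N-tracking, ‖P_t w_R‖₂ ≤ C N^m e^(−c t N^(−b)) (then any a > b works); stretched-exponential or
t^(−k) N^m decay also suffices. Consistent with λ_S ≤ γ/N (BeckerMenegaki2022_gapClosing), with the
equilibrium transport bound λ ≤ 4√2 γ ln(2C)/√N (equilibrium_rate_bound) and with the harmonic N⁻³.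
[difficulty: XL] (why it might fail: N-dependent lower bounds on relaxation exist only near-harmonic
(Menegaki2020: N⁻³-type under N⁻⁶-small anharmonicity); metastable high-energy states could make
contact relaxation slower than any power of N (cf. essential spectrum at 0 when pinning dominates,
HairerMattingly2009 — not our degrees).) [BeckerMenegaki2022, Menegaki2020,
CuneoEckmannHairerReyBellet2018, HairerMattingly2009, Znidaric2015]
#4 DarkTime (crux) — (W1, card crux 3, integrated form) for all parameters > 0 and T > 0 there is v
> 0 with (N−1) T⁻² ∫₀^(N/v) |c_N(t)| dt → 0. Sufficient: a covariance-form classical Lieb–Robinson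
bound for the thermal pinned chain, |Cov_(μ_T)(w_L, P_t w_R)| ≤ C (1+t)^m e^(−c(N − v₀t)) for t ≤
N/v₀ (take v = 2v₀); note c_N(0) = 0 exactly (p_0 ⊥ p_(N−1) under μ_T) and equal-time spatial
correlations of μ_T decay exponentially (1-D transfer operator). [difficulty: L] (why it might fail:
sup-norm Lieb–Robinson is false for unbounded (quartic) forces; the printed Gibbs-averaged bounds
(ButtaEtAl2007) have cones r ∼ t log^α t, so a fixed v may need 'no mass just after arrival' in
addition; Langevin contacts must not spoil quasi-locality.) [NachtergaeleEtAl2008, RazSims2009,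
ButtaEtAl2007, MarchioroPellegrinottiPulvirenti1978]
#5 ContactKubo (support) — [support, theorem-grade, fixed N] CONTACT FORM OF THE FINITE-VOLUME KUBO
FORMULA: for all parameters > 0, IF weak steady states (IsSteadyState) are unique for all N, T_L,
T_R > 0 (= NessUnique), then for every T > 0 and N = n+2: t ↦ c_N(t) is integrable on (0,∞), and for
every family μ of weak steady states the linear response exists with lim_(δ→0,δ≠0) totalCurrent(μ N
(T+δ/2) (T−δ/2))/δ = (N−1) T⁻² ∫₀^∞ c_N(t) dt. Content: (a) Hairer–Majda linear response for the
hypoelliptic Langevin chain (CEHR Lyapunov/spectral-gap structure), response of J̃ = μ_δ(w_L^(T_L))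
to ∂_δ L = (γ/2)(∂²_(p_0) − ∂²_(p_(N−1))): G_N = γ/2 + (2T²)⁻¹ ∫₀^∞ ⟨w_R − w_L, P_t w_L⟩ dt; (b)
Π-reversibility (P_t* = Π P_t Π in L²(μ_T), w's even) gives ⟨w_R, P_t w_L⟩ = ⟨w_L, P_t w_R⟩; (c) the
single-bath sum rule ∫₀^∞ ⟨w_L, P_t(w_L + w_R)⟩ = ⟨w_L, μ_T(H) − H⟩ = γ Cov(p_0², H) = γT² (L H =
w_L + w_R: generator_hamiltonian_two_baths, PROVED) kills the auto term: G_N = T⁻² ∫₀^∞ c_N; all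
bond currents have mean J̃ in the (smooth, all moments) steady state, totalCurrent = (N−1) J̃.
Checked numerically (planner, harmonic N = 2,3,4, Lyapunov equation vs. matrix-exponential
quadrature): J̃/δ = T⁻²∫c_N to 6 digits (0.166667, 0.136364, 0.127907 at ω₂ = γ = T = 1) and a + c =
γT². Shares its hypothesis and most of its infrastructure with FourierGreenKubo's FiniteResponse
(stmt-0717) and KuboFormula (LangevinSemigroup.lean). [difficulty: XL] [HairerMajda2009,
ReyBellet2003, KunduDharNarayan2009, JaksicOgataPillet2006, MaesNetocnyVerschuere2003,
CuneoEckmannHairerReyBellet2018, BonettoLebowitzReyBellet2000]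
#5 NessUnique (support) — [support, shared verbatim with route FourierGreenKubo item
stmt-AtomisticToContinuum-0741] uniqueness of the weak steady state (IsSteadyState class) of
pinnedChain for all N, T_L, T_R > 0; the hypothesis of ContactKubo and, with the landed existence
fact, clause (i) of FouriersLawFor. [difficulty: L] [CuneoEckmannHairerReyBellet2018, Carmona2007]
#9 EchoBounds (support) — [support, sanity anchor, fixed N] 0 ≤ ∫₀^∞ c_N ≤ γT²/2, i.e. 0 ≤ G_N ≤ γ/2
(given integrability): upper bound from c = ¼[⟨w_L+w_R, R(w_L+w_R)⟩ − ⟨w_L−w_R, R(w_L−w_R)⟩] = γT²/2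
− 𝓔/4 with R = (−L)⁻¹ = ∫₀^∞ P_t and 𝓔 ≥ 0 (accretivity); lower bound = second law at first order
(entropy production J̃(1/T_R − 1/T_L) ≥ 0) or the harmonic-comparison-free identity route. Equality
G = γ/2 iff 𝓔 = 0 (N = 1 analogue: G_1 = γ/2). A numerical violation would signal a convention slip
in c_N, not physics. [difficulty: M] [BonettoLebowitzReyBellet2000, MaesNetocnyVerschuere2003,
ReyBellet2003]
#9 EchoLimitOfWindows (support) — [support, glue] the three windows plus integrability (from
ContactKubo under NessUnique) give the target: split ∫₀^∞ = ∫₀^(N/v) + ∫_(N/v)^(N^a) + ∫_(N^a)^∞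
with v from DarkTime and a from PolynomialGapTail, apply EquilibriumFluctuationWindow at (v, a);
pure real analysis (set-integral additivity on Ioc/Icc/Ioi, squeeze), ~100 lines. [difficulty:
provable-now] [BonettoLebowitzReyBellet2000]

TWO-LAYER PLAN. Foreseen glued splits (k ≤ 3, depth 1), filed only after a crux closes or a prover
proposes: EquilibriumFluctuationWindow ⇐ (ScalingLimit:
N³ c_N(N² s) → T² K_T(s) locally uniformly on (0,∞)) → (UniformIntegrability: (N−1)|c_N| dominated
on [N/v, εN²] ∪ [AN², N^a]) → W2;
PolynomialGapTail ⇐ (ContactGapBound: ‖P_t w_R‖_(L²(μ_T)) ≤ C N^m e^(−ctN^(−b))) → W3; DarkTime ⇐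
(CovarianceLiebRobinson: |Cov(w_L, P_t w_R)| ≤
C(1+t)^m e^(−c(N−v₀t))) → W1; ContactKubo ⇐ (FiniteResponse = stmt-0717) → (MixedKuboForm) →
(SumRule) → K.

KILL CRITERIA. ¬EquilibriumFluctuationWindow with a proof that hyperbolic or polynomial windows
carry Θ(1/N) mass, or that the window limit is 0 or ∞ for
admissible parameters, closes the route (refuted:EquilibriumFluctuationWindow) — if the limit merely
depends on (v, a) pivot to a restated W2
with the windows that work. ¬PolynomialGapTail for every a (contact relaxation slower than any power
of N) forces a pivot to a
stretched-exponential tail statement or closes the line if (N−1)∫_(N^a)^∞|c_N| ↛ 0 for all a.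
¬ContactKubo (linear response fails or the
cross form is wrong) kills the whole contact programme (and FourierGreenKubo's 0717 with it). A
refutation of NessUnique refutes clause (i) of
the conjunct itself. FouriersLaw proved via FourierGreenKubo moots the route; EchoLimit proved
elsewhere reduces it to ContactKubo.

NOT DECOMPOSED YET. The scaling-limit/uniform-integrability split of W2 and the identification of
κ(T) (Robin kernel, Kapitza length); the pointwise gap
bound behind W3 and its exponent b; the covariance Lieb–Robinson inequality behind W1 and its
velocity; the Hairer–Majda verification and
the Π-reversibility/sum-rule lemmas inside ContactKubo; positivity (P′) c_N ≥ 0 (true for every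
harmonic chain, hence not diagnostic —
refuter audit) is NOT filed.

CHEAPEST FALSIFIER. Equilibrium MD of the open chain (ω₂ = lam = β = γ = 1, T ∈ {1, 0.1}, N ∈
{8,…,256}): estimate c_N(t) = ⟨w_L(0) w_R(t)⟩ (no temperature
difference, signal O(1/N) directly). The line dies if (N−1)∫c_N fails to plateau (numerical Fourier
law says it plateaus) and is CALIBRATED
otherwise: onset ≈ N/v (W1), bulk of the mass at t ∼ N² (W2), terminal exponential rate vs N (W3:
fit b; b < 3 expected away from the harmonic
corner). Identity check already run by the planner (harmonic N = 2,3,4, exact Gaussian formulas):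
G_N = T⁻²∫c_N ✓, a + c = γT² ✓, 0 ≤ G_N ≤ γ/2 ✓.
Lookup falsifier for novelty: a printed windowed proof of D_N → κ for ANY boundary-driven
Hamiltonian chain (none found, see Novelty).

NUMBERS. Harmonic chain (lam = β = 0, outside the conjunct): λ_S ≍ N⁻³ (BeckerMenegaki2022 Thm 1),
ballistic, W2 fails, W1/W3 hold — so a > b ≥ 3
there; equilibrium transport bound for every chain: any L²(μ_T) rate with prefactor C obeys λ ≤ 4√2
γ ln(2C)/√N (equilibrium_rate_bound,
PROVED); G_1 = γ/2, 0 ≤ G_N ≤ γ/2; harmonic G_N at ω₂ = γ = T = 1: 0.1667, 0.1364, 0.1279 (N =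
2,3,4) → c_∞ > 0 (ballistic). Items at open: 9
(3 cruxes, 1 target, 4 support, 1 assembly).

DEFINITION REQUESTS. None blocking: c_N is inlined over OscillatorChain.transitionKernel /
gibbsMeasure. Nice-to-have (filed later if provers ask): `contactPower`,
`contactEcho` abbreviations under Summits/AtomisticToContinuum/FouriersLaw/Theorems to shorten
signatures.

Novelty: Searches (2026-08-15, this planner; plus the card's and the refuter audit's of the same day): `lit
frontier AtomisticToContinuum --since 2020` (30 rows;
heat-conduction descendants arXiv:2606.08839, arXiv:2604.14056, arXiv:2310.13338 — none
windowed/open-GK); `lit bridges AtomisticToContinuum --cross any`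
(30 rows, none relevant); `lit search --hybrid "Green-Kubo formula open system boundary reservoir
current cross-correlation conductance Langevin chain"`
(12 textbook hits: Kipnis–Landim, Evans–Morriss, Gaspard 2022, Attal–Joye–Pillet vol. II — generic
GK, no contact-cross windowing); `lit galaxy search
--star all` ×2 (0 hits) and `--star pdf "heat conduction networks"` (BLLO 2009 only); crossref for
Komorowski–Olla thermal boundaries (doi:10.1007/978-3-030-82946-9_11,
doi:10.1214/21-ejp581, doi:10.1016/j.jfa.2020.108764). Nearest prior art found:
JaksicOgataPillet2006 (eq. (1.1), §2.4: kinetic coefficient = ½∫ω_β(Φ_A τ^t Φ_C)dt,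
cross-correlation of two reservoir fluxes, quantum), MaesNetocnyVerschuere2003 and
KunduDharNarayan2009 (classical open-system Green–Kubo, mixed/auto
forms with the O(1) subtraction), NachtergaeleEtAl2008 / RazSims2009 / ButtaEtAl2007 (classical
Lieb–Robinson, never tied to conductance limits),
Menegaki2020 / BeckerMenegaki2022 (N-dependent rates), KomorowskiOlla2021 (thermal boundary
conditions, harmonic/noisy).
Delta: the white-noise sum rule + cross form make the Kubo integrand O(1/N) with no subtraction, and
windowing it by a Lieb–Robinson dark t  [refs: 10.1007/978-3-030-82946-9_11, 10.1214/21-ejp581, 10.1016/j.jfa.2020.108764, 2606.08839, 2604.14056, 2310.13338, doi:10.1007/978-3-030-82946-9_11, doi:10.1214/21-ejp581, doi:10.1016/j.jfa.2020.108764, JaksicOgataPillet2006, MaesNetocnyVerschuere2003, KunduDharNarayan2009, NachtergaeleEtAl2008, RazSims2009, ButtaEtAl2007, Menegaki2020, BeckerMenegaki2022, KomorowskiOlla2021]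

Barriers (technique_class: contact-green-kubo time-windows polynomial-gap-tail): - technique_class: contact-green-kubo time-windows polynomial-gap-tail
- Literature.Barriers.AtomisticToContinuum.BeckerMenegaki2022_gapClosing: EMBRACED — W3 asks only
SOME polynomial rate N^(−b) for contact observables (a > b free), never an N-uniform gap; consistent
with λ_S ≤ γ/N and with the companion equilibrium transport bound λ ≤ 4√2 γ ln(2C)/√N
(`equilibrium_rate_bound`, PROVED): rates are used only at times t ≥ N^a ≫ N².
- Literature.Barriers.AtomisticToContinuum.MacroErgodicityBarrier: it does not fully evade; the bet
is that W2 sits at the barrier's weakest corner — EQUILIBRIUM (no NESS), two boundary observables,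
second moments, a time WINDOW whose ends are cut by W1/W3 — so no relative-entropy/one-block
statement for all local functions and no sector condition is needed.
- Literature.Barriers.AtomisticToContinuum.HasBoundedResponse: evaded by construction — this is a
limit theorem across N, and fixed-N theory enters only through W3's rate whose N-dependence is
exactly what is tracked (polynomially); HasBoundedResponse follows from W1–W3 but is not used as an
input.
- Literature.Barriers.AtomisticToContinuum.HarmonicChainBallisticFlux: consistent — at lam = β = 0
W1 and W3 hold while W2 fails ((N−1)∫c_N → ∞, c_∞ > 0: planner numerics 0.167, 0.136, 0.128,… ↛
0·N⁻¹), so the skeleton produces no false Fourier law; nothing here is perturbative around the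
harmonic point.
- Literature.Barriers.AtomisticToContinuum.Mazur1969_inequality: an extensive odd conserved charge

History (route lifecycle, newest last):
- 2026-08-15T13:41:25Z · CLOSED retired — not-a-thesis: assembly does not conclude the sub-problem Statement (operator:999:1257524)

sub-problem: FouriersLaw · status: closed(retired) · opened planner-plancard-AtomisticToContinuum-Fourier-47b6c42a-0 2026-08-15T11:17:14Z · rev 0 · ledger route-AtomisticToContinuum-ContactEchoWindows
GENERATED by the gate from the ledger (D-0016/17). Provers cite these decls: `theorem foo : Summit.AtomisticToContinuum.FouriersLaw.Theses.ContactEchoWindows.<Decl> := …` in Summits/AtomisticToContinuum/FouriersLaw/Theorems/<Name>.lean.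
-/

namespace Summit.AtomisticToContinuum.FouriersLaw.Theses.ContactEchoWindows

open scoped BigOperators Topology Manifold Classical MeasureTheory ProbabilityTheory Matrix InnerProductSpace ComplexConjugate ContinuousMap
open Filter Set Function TopologicalSpace MeasureTheory

attribute [summit_statement] _root_.FouriersLaw

/-- item stmt-AtomisticToContinuum-3362 · target · rank 0 · closed · moot by None · by planner
why it might fail: inherits W2 (a deterministic-chain equilibrium fluctuation limit, MacroErgodicity class) and W3 (no N-polynomial relaxation bound exists beyond near-harmonic chains); κ might exist only along subsequences if hyperbolic/polynomial windows carry mass.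
sources: BonettoLebowitzReyBellet2000, KunduDharNarayan2009, JaksicOgataPillet2006, Bernardin2014, BeckerMenegaki2022
[target] CONTACT-ECHO FORM OF FOURIER'S LAW: for all ω₂, lam, β, γ > 0 and T > 0 there is κ > 0 with
(N−1) T⁻² ∫₀^∞ c_N(t) dt → κ as N → ∞ (N = n+2; c_N as in the Thesis; the set integral is Lean-junk
0 unless c_N ∈ L¹(0,∞), which ContactKubo supplies). With ContactKubo this is exactly "D_N → κ(T) ∈
(0,∞)". -/
@[route_item "route-AtomisticToContinuum-ContactEchoWindows"]
def EchoLimit : Prop :=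
  ∀ ω₂ lam β γ : ℝ, 0 < ω₂ → 0 < lam → 0 < β → 0 < γ → ∀ T : ℝ, 0 < T → ∃ κ : ℝ, 0 < κ ∧ Filter.Tendsto (fun n : ℕ => ((n : ℝ) + 1) / T ^ 2 * ∫ t in Set.Ioi (0 : ℝ), (∫ z, γ * (T - (z.2 0) ^ 2) * (∫ y, γ * (T - (y.2 (Fin.last (n + 1))) ^ 2) ∂((Literature.MathematicalPhysics.KineticTheory.HeatConduction.pinnedChain ω₂ lam β γ).transitionKernel (n + 2) T T (Real.toNNReal t) z)) ∂((Literature.MathematicalPhysics.KineticTheory.HeatConduction.pinnedChain ω₂ lam β γ).gibbsMeasure (n + 2) T))) Filter.atTop (nhds κ)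

/-- item stmt-AtomisticToContinuum-3363 · crux · rank 2 · closed · moot by None · by planner
why it might fail: Boltzmann–Gibbs / fluctuation–dissipation for a DETERMINISTIC anharmonic chain is open even at equilibrium (MacroErgodicity class); the contact boundary condition (Kapitza length) is identified only for harmonic/noisy chains; '∀ a' also asserts no mass at polynomial times ≫ N².
sources: Bernardin2014, KomorowskiOlla2021, KomorowskiOllaSimon2021, KomorowskiOlla2020, BonettoLebowitzReyBellet2000, arXiv:2310.13338
[crux] (W2, card crux 1) for all parameters > 0 and T > 0 there is κ > 0 such that for EVERY v > 0
and EVERY a > 2: (N−1) T⁻² ∫_(N/v)^(N^a) c_N(t) dt → κ. Informally: on diffusive scales N³ c_N(N² s)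
→ T² K(s), K = contact-to-contact flux kernel of ∂_s e = κ ∂_x² e on [0,1] with thermalising
(Robin/Kapitza) boundary conditions, ∫₀^∞ K = κ, with enough uniform integrability that hyperbolic
times t ∈ [N/v, εN²] and polynomial times t ∈ [AN², N^a] carry o(1/N); an EQUILIBRIUM
energy-fluctuation limit for two boundary observables of the OPEN chain (Ornstein–Uhlenbeck
fluctuation field + Boltzmann–Gibbs principle for w_L, w_R), the corner where κ(T) is defined.
[difficulty: open-problem] -/
@[route_item "route-AtomisticToContinuum-ContactEchoWindows"]
def EquilibriumFluctuationWindow : Prop :=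
  ∀ ω₂ lam β γ : ℝ, 0 < ω₂ → 0 < lam → 0 < β → 0 < γ → ∀ T : ℝ, 0 < T → ∃ κ : ℝ, 0 < κ ∧ ∀ v : ℝ, 0 < v → ∀ a : ℝ, 2 < a → Filter.Tendsto (fun n : ℕ => ((n : ℝ) + 1) / T ^ 2 * ∫ t in Set.Icc (((n : ℝ) + 2) / v) (((n : ℝ) + 2) ^ a), (∫ z, γ * (T - (z.2 0) ^ 2) * (∫ y, γ * (T - (y.2 (Fin.last (n + 1))) ^ 2) ∂((Literature.MathematicalPhysics.KineticTheory.HeatConduction.pinnedChain ω₂ lam β γ).transitionKernel (n + 2) T T (Real.toNNReal t) z)) ∂((Literature.MathematicalPhysics.KineticTheory.HeatConduction.pinnedChain ω₂ lam β γ).gibbsMeasure (n + 2) T))) Filter.atTop (nhds κ)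

/-- item stmt-AtomisticToContinuum-3364 · crux · rank 3 · closed · moot by None · by planner
why it might fail: N-dependent lower bounds on relaxation exist only near-harmonic (Menegaki2020: N⁻³-type under N⁻⁶-small anharmonicity); metastable high-energy states could make contact relaxation slower than any power of N (cf. essential spectrum at 0 when pinning dominates, HairerMattingly2009 — not our degrees).
sources: BeckerMenegaki2022, Menegaki2020, CuneoEckmannHairerReyBellet2018, HairerMattingly2009, Znidaric2015
[crux] (W3, card crux 2, integrated form) for all parameters > 0 and T > 0 there is a > 2 such that
t ↦ c_N(t) is integrable on (N^a, ∞) for every N and (N−1) T⁻² ∫_(N^a)^∞ |c_N(t)| dt → 0.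
Sufficient: an L²(μ_T) relaxation bound for the contact observable with POLYNOMIAL N-tracking, ‖P_t
w_R‖₂ ≤ C N^m e^(−c t N^(−b)) (then any a > b works); stretched-exponential or t^(−k) N^m decay also
suffices. Consistent with λ_S ≤ γ/N (BeckerMenegaki2022_gapClosing), with the equilibrium transport
bound λ ≤ 4√2 γ ln(2C)/√N (equilibrium_rate_bound) and with the harmonic N⁻³. [difficulty: XL] -/
@[route_item "route-AtomisticToContinuum-ContactEchoWindows"]
def PolynomialGapTail : Prop :=
  ∀ ω₂ lam β γ : ℝ, 0 < ω₂ → 0 < lam → 0 < β → 0 < γ → ∀ T : ℝ, 0 < T → ∃ a : ℝ, 2 < a ∧ (∀ n : ℕ, MeasureTheory.IntegrableOn (fun t : ℝ => (∫ z, γ * (T - (z.2 0) ^ 2) * (∫ y, γ * (T - (y.2 (Fin.last (n + 1))) ^ 2) ∂((Literature.MathematicalPhysics.KineticTheory.HeatConduction.pinnedChain ω₂ lam β γ).transitionKernel (n + 2) T T (Real.toNNReal t) z)) ∂((Literature.MathematicalPhysics.KineticTheory.HeatConduction.pinnedChain ω₂ lam β γ).gibbsMeasure (n + 2) T))) (Set.Ioi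 (((n : ℝ) + 2) ^ a))) ∧ Filter.Tendsto (fun n : ℕ => ((n : ℝ) + 1) / T ^ 2 * ∫ t in Set.Ioi (((n : ℝ) + 2) ^ a), |(∫ z, γ * (T - (z.2 0) ^ 2) * (∫ y, γ * (T - (y.2 (Fin.last (n + 1))) ^ 2) ∂((Literature.MathematicalPhysics.KineticTheory.HeatConduction.pinnedChain ω₂ lam β γ).transitionKernel (n + 2) T T (Real.toNNReal t) z)) ∂((Literature.MathematicalPhysics.KineticTheory.HeatConduction.pinnedChain ω₂ lam β γ).gibbsMeasure (n + 2) T))|) Filter.atTop (nhds 0)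

/-- item stmt-AtomisticToContinuum-3365 · crux · rank 4 · closed · moot by None · by planner
why it might fail: sup-norm Lieb–Robinson is false for unbounded (quartic) forces; the printed Gibbs-averaged bounds (ButtaEtAl2007) have cones r ∼ t log^α t, so a fixed v may need 'no mass just after arrival' in addition; Langevin contacts must not spoil quasi-locality.
sources: NachtergaeleEtAl2008, RazSims2009, ButtaEtAl2007, MarchioroPellegrinottiPulvirenti1978
[crux] (W1, card crux 3, integrated form) for all parameters > 0 and T > 0 there is v > 0 with (N−1)
T⁻² ∫₀^(N/v) |c_N(t)| dt → 0. Sufficient: a covariance-form classical Lieb–Robinson bound for the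
thermal pinned chain, |Cov_(μ_T)(w_L, P_t w_R)| ≤ C (1+t)^m e^(−c(N − v₀t)) for t ≤ N/v₀ (take v =
2v₀); note c_N(0) = 0 exactly (p_0 ⊥ p_(N−1) under μ_T) and equal-time spatial correlations of μ_T
decay exponentially (1-D transfer operator). [difficulty: L] -/
@[route_item "route-AtomisticToContinuum-ContactEchoWindows"]
def DarkTime : Prop :=
  ∀ ω₂ lam β γ : ℝ, 0 < ω₂ → 0 < lam → 0 < β → 0 < γ → ∀ T : ℝ, 0 < T → ∃ v : ℝ, 0 < v ∧ Filter.Tendsto (fun n : ℕ => ((n : ℝ) + 1) / T ^ 2 * ∫ t in Set.Icc 0 (((n : ℝ) + 2) / v), |(∫ z, γ * (T - (z.2 0) ^ 2) * (∫ y, γ * (T - (y.2 (Fin.last (n + 1))) ^ 2) ∂((Literature.MathematicalPhysics.KineticTheory.HeatConduction.pinnedChain ω₂ lam β γ).transitionKernel (n + 2) T T (Real.toNNReal t) z)) ∂((Literature.MathematicalPhysics.KineticTheory.HeatConduction.pinnedChain ω₂ lam β γ).gibbsMeasure (n + 2) T))|) Filter.atTop (nhds 0)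

/-- item stmt-AtomisticToContinuum-0741 · support · rank 5 · closed · proved by Summit.AtomisticToContinuum.FouriersLaw.Theorems.nessUnique_proof (prover) · by planner
sources: CuneoEckmannHairerReyBellet2018, Carmona2007
[crux] UNIQUENESS OF THE WEAK STEADY STATE (the half of stmt-0706 not covered by the landed fact
Literature.MathematicalPhysics.KineticTheory.HeatConduction.CuneoEckmannHairerReyBellet2018_pinnedChain,
p3544): for pinnedChain ω₂ lam β γ (all > 0), every N and T_L, T_R > 0, any two measures in the weak
Fokker–Planck class IsSteadyState (probability, ∫ L f dμ = 0 for f ∈ C_c^∞, bond currents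
integrable) coincide. Print: uniqueness of the INVARIANT MEASURE of the Langevin semigroup
(CuneoEckmannHairerReyBellet2018 Thm 2.13(1): C1, C2, CA; Carmona2007 Thm 1.1(iii)); the item
additionally needs 'weak stationary probability solution of L*μ = 0 ⇒ P_t-invariant' for this
hypoelliptic L with cubic drift (Echeverría 1982 well-posed martingale problem on C_c^∞ +
non-explosion via e^{θH}; Bogachev–Krylov–Röckner–Shaposhnikov 2015 Ch. 5 is non-degenerate only) —
the FP-identification lemma is the formal crux. N = 0: PhaseSpace 0 is a point (unique probability
measure); N = 1: both baths on site 0, OU at temperature (T_L+T_R)/2. This is exactly the hypothesis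
of FiniteResponse and ThermodynamicLimit and, with the fact, gives clause (i) of FouriersLawFor. -/
@[route_item "route-AtomisticToContinuum-ContactEchoWindows"]
def NessUnique : Prop :=
  ∀ ω₂ lam β γ : ℝ, 0 < ω₂ → 0 < lam → 0 < β → 0 < γ → ∀ (N : ℕ) (T_L T_R : ℝ), 0 < T_L → 0 < T_R → ∀ μ ν : MeasureTheory.Measure (Literature.MathematicalPhysics.KineticTheory.HeatConduction.PhaseSpace N), (Literature.MathematicalPhysics.KineticTheory.HeatConduction.pinnedChain ω₂ lam β γ).IsSteadyState N T_L T_R μ → (Literature.MathematicalPhysics.KineticTheory.HeatConduction.pinnedChain ω₂ lam β γ).IsSteadyState N T_L T_R ν → μ = ν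

/-- item stmt-AtomisticToContinuum-3366 · support · rank 5 · closed · moot by None · by planner
sources: HairerMajda2009, ReyBellet2003, KunduDharNarayan2009, JaksicOgataPillet2006, MaesNetocnyVerschuere2003, CuneoEckmannHairerReyBellet2018
[support] [support, theorem-grade, fixed N] CONTACT FORM OF THE FINITE-VOLUME KUBO FORMULA: for all
parameters > 0, IF weak steady states (IsSteadyState) are unique for all N, T_L, T_R > 0 (=
NessUnique), then for every T > 0 and N = n+2: t ↦ c_N(t) is integrable on (0,∞), and for every
family μ of weak steady states the linear response exists with lim_(δ→0,δ≠0) totalCurrent(μ N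
(T+δ/2) (T−δ/2))/δ = (N−1) T⁻² ∫₀^∞ c_N(t) dt. Content: (a) Hairer–Majda linear response for the
hypoelliptic Langevin chain (CEHR Lyapunov/spectral-gap structure), response of J̃ = μ_δ(w_L^(T_L))
to ∂_δ L = (γ/2)(∂²_(p_0) − ∂²_(p_(N−1))): G_N = γ/2 + (2T²)⁻¹ ∫₀^∞ ⟨w_R − w_L, P_t w_L⟩ dt; (b)
Π-reversibility (P_t* = Π P_t Π in L²(μ_T), w's even) gives ⟨w_R, P_t w_L⟩ = ⟨w_L, P_t w_R⟩; (c) the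
single-bath sum rule ∫₀^∞ ⟨w_L, P_t(w_L + w_R)⟩ = ⟨w_L, μ_T(H) − H⟩ = γ Cov(p_0², H) = γT² (L H =
w_L + w_R: generator_hamiltonian_two_baths, PROVED) kills the auto term: G_N = T⁻² ∫₀^∞ c_N; all
bond currents have mean J̃ in the (smooth, all moments) steady state, totalCurrent = (N−1) J̃.
Checked numerically (planner, harmonic N = 2,3,4, Lyapunov equation vs. matrix-exponential
quadrature): J̃/δ = T⁻²∫c_N to 6 digits (0 -/
@[route_item "route-AtomisticToContinuum-ContactEchoWindows"]
def ContactKubo : Prop :=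
  ∀ ω₂ lam β γ : ℝ, 0 < ω₂ → 0 < lam → 0 < β → 0 < γ → (∀ (N : ℕ) (T_L T_R : ℝ), 0 < T_L → 0 < T_R → ∀ μ ν : MeasureTheory.Measure (Literature.MathematicalPhysics.KineticTheory.HeatConduction.PhaseSpace N), (Literature.MathematicalPhysics.KineticTheory.HeatConduction.pinnedChain ω₂ lam β γ).IsSteadyState N T_L T_R μ → (Literature.MathematicalPhysics.KineticTheory.HeatConduction.pinnedChain ω₂ lam β γ).IsSteadyState N T_L T_R ν → μ = ν) → ∀ T : ℝ, 0 < T → ∀ n : ℕ, MeasureTheory.IntegrableOn (fun t : ℝ => (∫ z, γ * (T - (z.2 0) ^ 2) * (∫ y, γ * (T - (y.2 (Fin.last (n + 1))) ^ 2) ∂((Literature.MathematicalPhysics.KineticTheory.HeatConduction.pinnedChain ω₂ lam β γ).transitionKernel (n + 2) T T (Real.toNNReal t) z)) ∂((Literature.MathematicalPhysics.KineticTheory.HeatConduction.pinnedChain ω₂ lam β γ).gibbsMeasure (n + 2) T))) (Set.Ioi 0) ∧ ∀ μ : (N : ℕ) → ℝ → ℝ → MeasureTheory.Measure (Literature.MathematicalPhysics.KineticTheory.HeatConduction.PhaseSpace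 N), (∀ (N : ℕ) (T_L T_R : ℝ), 0 < T_L → 0 < T_R → (Literature.MathematicalPhysics.KineticTheory.HeatConduction.pinnedChain ω₂ lam β γ).IsSteadyState N T_L T_R (μ N T_L T_R)) → Filter.Tendsto (fun δ : ℝ => (Literature.MathematicalPhysics.KineticTheory.HeatConduction.pinnedChain ω₂ lam β γ).totalCurrent (μ (n + 2) (T + δ / 2) (T - δ / 2)) / δ) (nhdsWithin 0 {(0 : ℝ)}ᶜ) (nhds (((n : ℝ) + 1) / T ^ 2 * ∫ t in Set.Ioi (0 : ℝ), (∫ z, γ * (T - (z.2 0) ^ 2) * (∫ y, γ * (T - (y.2 (Fin.last (n + 1))) ^ 2) ∂((Literature.MathematicalPhysics.KineticTheory.HeatConduction.pinnedChain ω₂ lam β γ).transitionKernel (n + 2) T T (Real.toNNReal t) z)) ∂((Literature.MathematicalPhysics.KineticTheory.HeatConduction.pinnedChain ω₂ lam β γ).gibbsMeasure (n + 2) T))))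

/-- item stmt-AtomisticToContinuum-3367 · support · rank 9 · closed · moot by None · by planner
sources: BonettoLebowitzReyBellet2000, MaesNetocnyVerschuere2003, ReyBellet2003
[support] [support, sanity anchor, fixed N] 0 ≤ ∫₀^∞ c_N ≤ γT²/2, i.e. 0 ≤ G_N ≤ γ/2 (given
integrability): upper bound from c = ¼[⟨w_L+w_R, R(w_L+w_R)⟩ − ⟨w_L−w_R, R(w_L−w_R)⟩] = γT²/2 − 𝓔/4
with R = (−L)⁻¹ = ∫₀^∞ P_t and 𝓔 ≥ 0 (accretivity); lower bound = second law at first order (entropy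
production J̃(1/T_R − 1/T_L) ≥ 0) or the harmonic-comparison-free identity route. Equality G = γ/2
iff 𝓔 = 0 (N = 1 analogue: G_1 = γ/2). A numerical violation would signal a convention slip in c_N,
not physics. [difficulty: M] -/
@[route_item "route-AtomisticToContinuum-ContactEchoWindows"]
def EchoBounds : Prop :=
  ∀ ω₂ lam β γ : ℝ, 0 < ω₂ → 0 < lam → 0 < β → 0 < γ → ∀ T : ℝ, 0 < T → ∀ n : ℕ, MeasureTheory.IntegrableOn (fun t : ℝ => (∫ z, γ * (T - (z.2 0) ^ 2) * (∫ y, γ * (T - (y.2 (Fin.last (n + 1))) ^ 2) ∂((Literature.MathematicalPhysics.KineticTheory.HeatConduction.pinnedChain ω₂ lam β γ).transitionKernel (n + 2) T T (Real.toNNReal t) z)) ∂((Literature.MathematicalPhysics.KineticTheory.HeatConduction.pinnedChain ω₂ lam β γ).gibbsMeasure (n + 2) T))) (Set.Ioi 0) → 0 ≤ (∫ t in Set.Ioi (0 : ℝ), (∫ z, γ * (T - (z.2 0) ^ 2) * (∫ y, γ * (T - (y.2 (Fin.last (n + 1))) ^ 2) ∂((Literature.MathematicalPhysics.KineticTheory.HeatConduction.pinnedChain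 ω₂ lam β γ).transitionKernel (n + 2) T T (Real.toNNReal t) z)) ∂((Literature.MathematicalPhysics.KineticTheory.HeatConduction.pinnedChain ω₂ lam β γ).gibbsMeasure (n + 2) T))) ∧ (∫ t in Set.Ioi (0 : ℝ), (∫ z, γ * (T - (z.2 0) ^ 2) * (∫ y, γ * (T - (y.2 (Fin.last (n + 1))) ^ 2) ∂((Literature.MathematicalPhysics.KineticTheory.HeatConduction.pinnedChain ω₂ lam β γ).transitionKernel (n + 2) T T (Real.toNNReal t) z)) ∂((Literature.MathematicalPhysics.KineticTheory.HeatConduction.pinnedChain ω₂ lam β γ).gibbsMeasure (n + 2) T))) ≤ γ * T ^ 2 / 2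

/-- item stmt-AtomisticToContinuum-3368 · support · rank 9 · closed · moot by None · by planner
sources: BonettoLebowitzReyBellet2000
[support] [support, glue] the three windows plus integrability (from ContactKubo under NessUnique)
give the target: split ∫₀^∞ = ∫₀^(N/v) + ∫_(N/v)^(N^a) + ∫_(N^a)^∞ with v from DarkTime and a from
PolynomialGapTail, apply EquilibriumFluctuationWindow at (v, a); pure real analysis (set-integral
additivity on Ioc/Icc/Ioi, squeeze), ~100 lines. [difficulty: provable-now] -/
@[route_item "route-AtomisticToContinuum-ContactEchoWindows"]
def EchoLimitOfWindows : Prop :=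
  ContactKubo → NessUnique → DarkTime → EquilibriumFluctuationWindow → PolynomialGapTail → EchoLimit

/-- item stmt-AtomisticToContinuum-3369 · assembly · rank 1 · closed · moot by None · by planner
sources: BonettoLebowitzReyBellet2000, CuneoEckmannHairerReyBellet2018
[assembly] (existence fact) → NessUnique → ContactKubo → DarkTime → EquilibriumFluctuationWindow →
PolynomialGapTail → FouriersLaw. -/
@[route_item "route-AtomisticToContinuum-ContactEchoWindows"]
def Assembly : Prop :=
  Literature.MathematicalPhysics.KineticTheory.HeatConduction.CuneoEckmannHairerReyBellet2018_pinnedChain → NessUnique → ContactKubo → DarkTime → EquilibriumFluctuationWindow → PolynomialGapTail → Literature.MathematicalPhysics.KineticTheory.HeatConduction.FouriersLaw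

end Summit.AtomisticToContinuum.FouriersLaw.Theses.ContactEchoWindows
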